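import Summits.CriticalPhenomena.SAWScalingLimit.Theorems.SAWLeftRightFKGFKGToTraversalBoundSlitNecklaceOutline
import Literature.Topology.PlaneTopology.StraightCrossCertificate
import Literature.Probability.LatticeModels.LatticeWalkWinding
import HarnessLib

/-!
# The wall-follower tour of a `4`-connected site set with `4`-connected complement is a single cycle

Crux `SAWLeftRightFKG.FKGToTraversalBound` (stmt-CriticalPhenomena-1878), line `slit-necklace`, lead
prover-line-stmt-CriticalPhenomena-1878-c5-0; witness unit U1 (wall-follower tour), on top of the vocabulary
`…SlitNecklaceOutline` (`ODir`, `IsBEdge`, `bnext`, `btour`, `bnext_cases`, `btour_isBEdge`).  Self-contained: the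
only periodicity used is a minimal RETURN TIME of some tour edge (pigeonhole), not the injectivity of `bnext`.

Registered stub `btour_transitive`: for a finite site set `A ⊆ ℤ²` which is `4`-connected and has `4`-connected
complement, the wall-follower tour from any boundary edge passes through EVERY boundary edge — the outline of `A`
is one closed tour.  The proof draws the tour in the plane and uses the tree's winding-number certificate of
separation `Literature.Topology.PlaneTopology.exists_mem_range_of_straightCross` (no Jordan curve theorem):

* planar realisation: the pixel of `x` is the unit square centred at `Site.toComplex x`; the boundary edge
  `(x, d)` is drawn as its DUAL SEGMENT `dualSeg (x, d)`, the side of that square facing `x + d`, from the start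
  corner `corner (x, d) = x + (d + d.cw) / 2` to the end corner `corner (x, d) + d.ccw` (`ODir.cvec`,
  `ODir.coff`: the unit vectors and corner offsets as complex numbers); `primalSeg (x, d)` is the segment between
  the centres of `x` and `x + d`;
* `corner_bnext` — one step of the wall follower starts where the previous edge ends, so the orbit of a boundary
  edge is drawn as a closed polygon (`exists_path_btour`);
* `eq_or_eq_of_mem_primalSeg_of_mem_dualSeg` — a primal unit segment meets a dual unit segment only if they are
  dual to each other (half-integer versus integer coordinates); hence lattice polygons (`walkPath`) inside `A`, or
  inside its complement, miss the dual segments of all boundary edges (`walkPath_notMem_dualSeg`), and the primal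
  edge of `(x, d)` crosses the drawn orbit exactly once within a minimal period;
* `segSide_corner`, `exists_mem_dualSeg_mem_openSegment` — the primal edge of `(x, d)` crosses the dual segment of
  `(x, d)` transversally at the common midpoint;
* `btour_transitive` — the tour of `e₀` repeats (finitely many boundary edges), so some tour edge `e = (x, d)`
  returns to itself; take its minimal return time.  If `e' = (x', d')` were not on the orbit, join the centre of
  `x'` to that of `x` inside `A` and the centre of `x + d` to that of `x' + d'` outside `A`; by the certificate the
  primal edge of `e'` meets the drawn orbit of `e`, i.e. the dual segment of a tour edge, which must then be `e'`.

All statements folklore (boundary tracing of a polyomino; Ahlfors, *Complex Analysis* (1979), §4.2.1 for the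
winding-number argument, already formalised in `StraightCrossCertificate.lean`); no literature fact is introduced;
nothing restates the crux.
-/

noncomputable section

open Set Complex
open Literature.Probability.LatticeModels Literature.Topology.PlaneTopology

namespace Summit.CriticalPhenomena.SAWScalingLimit.Theorems.FKGToTraversalBound.SlitNecklace

/-! ### Planar realisation of boundary edges -/

namespace ODir

/-- The unit vector of a direction, as a complex number. [folklore] -/
def cvec : ODir → ℂ
  | 0 => 1
  | 1 => I
  | 2 => -1
  | 3 => -I

/-- The offset from a pixel centre to the START corner of the dual edge in direction `d`:
`(vec d + vec (cw d)) / 2`. [folklore] -/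
def coff : ODir → ℂ
  | 0 => ⟨1 / 2, -1 / 2⟩
  | 1 => ⟨1 / 2, 1 / 2⟩
  | 2 => ⟨-1 / 2, 1 / 2⟩
  | 3 => ⟨-1 / 2, -1 / 2⟩

/-- The corner offset is `(vec d + vec (cw d)) / 2`. [folklore] -/
theorem two_mul_coff (d : ODir) : 2 * d.coff = d.cvec + d.cw.cvec := by
  fin_cases d <;> apply Complex.ext <;> simp [coff, cvec, cw] <;> norm_num

/-- `toComplex` turns a lattice step into adding the unit vector. [folklore] -/
theorem toComplex_add_vec (x : Site 2) (d : ODir) : Site.toComplex (x + d.vec) = Site.toComplex x + d.cvec := by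
  fin_cases d <;> apply Complex.ext <;> simp [vec, cvec, Site.toComplex]

end ODir

/-- The START corner of the boundary edge `e = (x, d)`: `x + (vec d + vec (cw d)) / 2`. [folklore] -/
def corner (e : Site 2 × ODir) : ℂ := Site.toComplex e.1 + e.2.coff

/-- The dual segment of the boundary edge `e`: from its start corner to its end corner
`corner e + vec (ccw d)`. [folklore] -/
def dualSeg (e : Site 2 × ODir) : Set ℂ := segment ℝ (corner e) (corner e + e.2.ccw.cvec)

/-- The primal segment of `e = (x, d)`: from the centre of the pixel `x` to the centre of `x + d`. [folklore] -/
def primalSeg (e : Site 2 × ODir) : Set ℂ := segment ℝ (Site.toComplex e.1) (Site.toComplex (e.1 + e.2.vec))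

/-- One step of the wall follower moves the start corner to the end corner. [folklore] -/
theorem corner_bnext (A : Set (Site 2)) (x : Site 2) (d : ODir) :
    corner (bnext A (x, d)) = corner (x, d) + d.ccw.cvec := by
  rcases bnext_cases A x d with ⟨-, h⟩ | ⟨-, -, h⟩ | ⟨-, -, h⟩ <;> rw [h] <;> simp only [corner] <;>
    fin_cases d <;> apply Complex.ext <;>
      simp [ODir.vec, ODir.cvec, ODir.coff, ODir.ccw, ODir.cw, Site.toComplex] <;> ring

/-- Along the tour, consecutive start corners differ by the unit vector of the travel direction. [folklore] -/
theorem corner_btour_succ (A : Set (Site 2)) (e₀ : Site 2 × ODir) (n : ℕ) :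
    corner (btour A e₀ (n + 1)) = corner (btour A e₀ n) + (btour A e₀ n).2.ccw.cvec := by
  rw [btour_succ]
  obtain ⟨x, d⟩ := btour A e₀ n
  exact corner_bnext A x d

/-! ### Primal versus dual segments -/

/-- **A primal unit segment meets a dual unit segment only if they are dual to each other**: if the segment
from the centre of `y` to the centre of `y + d₁` meets the dual segment of `(x, d)`, then `(x, d) = (y, d₁)` or
`(x, d)` is `(y, d₁)` read from the other side (`x = y + d₁`, `x + d = y`). [folklore] -/
theorem eq_or_eq_of_mem_primalSeg_of_mem_dualSeg {x y : Site 2} {d d₁ : ODir} {z : ℂ}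
    (hz : z ∈ primalSeg (y, d₁)) (hz' : z ∈ dualSeg (x, d)) :
    (x = y ∧ d = d₁) ∨ (x = y + d₁.vec ∧ x + d.vec = y) := by
  rw [primalSeg, ODir.toComplex_add_vec] at hz
  obtain ⟨t, ht0, ht1, hre, him⟩ := exists_of_mem_segment hz
  obtain ⟨s, hs0, hs1, hre', him'⟩ := exists_of_mem_segment hz'
  rw [hre] at hre'
  rw [him] at him'
  simp only [Site.eq_iff_two]
  fin_cases d <;> fin_cases d₁ <;>
    simp [corner, ODir.vec, ODir.cvec, ODir.coff, ODir.ccw, Site.toComplex, Pi.add_apply] at hre' him' ⊢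
  -- d = E
  · have h0 := int_eq_of_add_eq_add_half ht0 ht1 (by linarith : (y 0 : ℝ) + t = x 0 + 1 / 2)
    have h1 := int_eq_of_add_eq_add_half hs0 hs1 (by linarith : (x 1 : ℝ) + s = y 1 + 1 / 2)
    omega
  · exact absurd (by linarith : (y 0 : ℝ) = x 0 + 1 / 2) (intCast_ne_add_half _ _)
  · have h0 := int_eq_of_add_eq_add_half ht0 ht1
      (by push_cast; linarith : (x 0 : ℝ) + t = ((y 0 - 1 : ℤ) : ℝ) + 1 / 2)
    have h1 := int_eq_of_add_eq_add_half hs0 hs1 (by linarith : (x 1 : ℝ) + s = y 1 + 1 / 2)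
    omega
  · exact absurd (by linarith : (y 0 : ℝ) = x 0 + 1 / 2) (intCast_ne_add_half _ _)
  -- d = N
  · exact absurd (by linarith : (y 1 : ℝ) = x 1 + 1 / 2) (intCast_ne_add_half _ _)
  · have h0 := int_eq_of_add_eq_add_half hs0 hs1 (by linarith : (y 0 : ℝ) + s = x 0 + 1 / 2)
    have h1 := int_eq_of_add_eq_add_half ht0 ht1 (by linarith : (y 1 : ℝ) + t = x 1 + 1 / 2)
    omega
  · exact absurd (by linarith : (y 1 : ℝ) = x 1 + 1 / 2) (intCast_ne_add_half _ _)
  · have h0 := int_eq_of_add_eq_add_half hs0 hs1 (by linarith : (y 0 : ℝ) + s = x 0 + 1 / 2)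
    have h1 := int_eq_of_add_eq_add_half ht0 ht1
      (by push_cast; linarith : (x 1 : ℝ) + t = ((y 1 - 1 : ℤ) : ℝ) + 1 / 2)
    omega
  -- d = W
  · have h0 := int_eq_of_add_eq_add_half ht0 ht1
      (by push_cast; linarith : (y 0 : ℝ) + t = ((x 0 - 1 : ℤ) : ℝ) + 1 / 2)
    have h1 := int_eq_of_add_eq_add_half hs0 hs1 (by linarith : (y 1 : ℝ) + s = x 1 + 1 / 2)
    omega
  · exact absurd (by linarith : (x 0 : ℝ) = y 0 + 1 / 2) (intCast_ne_add_half _ _)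
  · have h0 := int_eq_of_add_eq_add_half ht0 ht1 (by linarith : (x 0 : ℝ) + t = y 0 + 1 / 2)
    have h1 := int_eq_of_add_eq_add_half hs0 hs1 (by linarith : (y 1 : ℝ) + s = x 1 + 1 / 2)
    omega
  · exact absurd (by linarith : (x 0 : ℝ) = y 0 + 1 / 2) (intCast_ne_add_half _ _)
  -- d = S
  · exact absurd (by linarith : (x 1 : ℝ) = y 1 + 1 / 2) (intCast_ne_add_half _ _)
  · have h0 := int_eq_of_add_eq_add_half hs0 hs1 (by linarith : (x 0 : ℝ) + s = y 0 + 1 / 2)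
    have h1 := int_eq_of_add_eq_add_half ht0 ht1
      (by push_cast; linarith : (y 1 : ℝ) + t = ((x 1 - 1 : ℤ) : ℝ) + 1 / 2)
    omega
  · exact absurd (by linarith : (x 1 : ℝ) = y 1 + 1 / 2) (intCast_ne_add_half _ _)
  · have h0 := int_eq_of_add_eq_add_half hs0 hs1 (by linarith : (x 0 : ℝ) + s = y 0 + 1 / 2)
    have h1 := int_eq_of_add_eq_add_half ht0 ht1 (by linarith : (x 1 : ℝ) + t = y 1 + 1 / 2)
    omega

/-- A pixel centre lies on no dual segment. [folklore] -/
theorem toComplex_notMem_dualSeg (y : Site 2) (e : Site 2 × ODir) : Site.toComplex y ∉ dualSeg e := by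
  intro h
  obtain ⟨x, d⟩ := e
  obtain ⟨s, hs0, hs1, hre, him⟩ := exists_of_mem_segment h
  fin_cases d <;> simp [corner, ODir.cvec, ODir.coff, ODir.ccw, Site.toComplex] at hre him
  · exact intCast_ne_add_half _ _ (by linarith : (y 0 : ℝ) = x 0 + 1 / 2)
  · exact intCast_ne_add_half _ _ (by linarith : (y 1 : ℝ) = x 1 + 1 / 2)
  · exact intCast_ne_add_half _ _ (by linarith : (x 0 : ℝ) = y 0 + 1 / 2)
  · exact intCast_ne_add_half _ _ (by linarith : (x 1 : ℝ) = y 1 + 1 / 2)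

/-! ### The straight piece, the polygon of the tour, lattice polygons -/

/-- **The straight piece is crossed by its primal edge.**  The start corner of `(x, d)` lies strictly on the
positive side, and the end corner strictly on the negative side, of the line from the centre of `x` to the centre of
`x + d`. [folklore] -/
theorem segSide_corner (x : Site 2) (d : ODir) :
    0 < segSide (Site.toComplex x) (Site.toComplex (x + d.vec)) (corner (x, d)) ∧
      segSide (Site.toComplex x) (Site.toComplex (x + d.vec)) (corner (x, d) + d.ccw.cvec) < 0 := by
  rw [ODir.toComplex_add_vec, segSide_eq, segSide_eq]
  constructor <;> fin_cases d <;> simp [corner, ODir.cvec, ODir.coff, ODir.ccw] <;> linarith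

/-- The dual segment and the open primal segment of `(x, d)` meet (at their common midpoint). [folklore] -/
theorem exists_mem_dualSeg_mem_openSegment (x : Site 2) (d : ODir) :
    ∃ p ∈ dualSeg (x, d), p ∈ openSegment ℝ (Site.toComplex x) (Site.toComplex (x + d.vec)) := by
  refine ⟨(1 / 2 : ℝ) • Site.toComplex x + (1 / 2 : ℝ) • Site.toComplex (x + d.vec), ?_,
    ⟨1 / 2, 1 / 2, by norm_num, by norm_num, by norm_num, rfl⟩⟩
  refine ⟨1 / 2, 1 / 2, by norm_num, by norm_num, by norm_num, ?_⟩
  rw [ODir.toComplex_add_vec]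
  simp only [corner]
  fin_cases d <;> apply Complex.ext <;> simp [ODir.cvec, ODir.coff, ODir.ccw] <;> ring

/-- **The polyline of the tour.**  A path from the start corner of the `m`-th tour edge to the start corner of the
`(m + n)`-th tour edge running along the dual segments of the tour edges `m, …, m + n - 1`. [folklore] -/
theorem exists_path_btour (A : Set (Site 2)) (e₀ : Site 2 × ODir) (m n : ℕ) :
    ∃ γ : Path (corner (btour A e₀ m)) (corner (btour A e₀ (m + n))),
      ∀ t, γ t = corner (btour A e₀ m) ∨ ∃ j, m ≤ j ∧ j < m + n ∧ γ t ∈ dualSeg (btour A e₀ j) := by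
  induction n with
  | zero => exact ⟨Path.refl _, fun t => Or.inl rfl⟩
  | succ n ih =>
    obtain ⟨γ, hγ⟩ := ih
    set σ : Path (corner (btour A e₀ (m + n))) (corner (btour A e₀ (m + n + 1))) :=
      (Path.segment (corner (btour A e₀ (m + n)))
        (corner (btour A e₀ (m + n)) + (btour A e₀ (m + n)).2.ccw.cvec)).cast rfl (corner_btour_succ A e₀ (m + n))
      with hσ
    have hσr : range σ = dualSeg (btour A e₀ (m + n)) := by
      rw [hσ, Path.cast_coe, Path.range_segment]; rfl
    refine ⟨γ.trans σ, fun t => ?_⟩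
    have ht := mem_range_self (f := γ.trans σ) t
    rw [Path.trans_range, hσr] at ht
    rcases ht with ⟨t', ht'⟩ | ht
    · rcases hγ t' with h | ⟨j, hj, hj', hmem⟩
      · exact Or.inl (ht' ▸ h)
      · exact Or.inr ⟨j, hj, by omega, ht' ▸ hmem⟩
    · exact Or.inr ⟨m + n, by omega, by omega, ht⟩

/-- **Lattice polylines miss the outline.**  A segment between two equal or adjacent lattice sites, both in `A` or
both outside `A`, misses the dual segment of every boundary edge of `A`: pixel centres lie on no dual segment, and
a primal edge meets only the dual segment dual to it, whose two readings `(u, d₁)`, `(v, d₁.rev)` are not boundary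
edges. [folklore] -/
theorem notMem_dualSeg_of_mem_segment {A : Set (Site 2)} {e : Site 2 × ODir} (he : IsBEdge A e) {u v : Site 2}
    (huv : u = v ∨ (zdGraph 2).Adj u v) (hA : (u ∈ A ∧ v ∈ A) ∨ (u ∉ A ∧ v ∉ A)) {z : ℂ}
    (hz : z ∈ segment ℝ (Site.toComplex u) (Site.toComplex v)) : z ∉ dualSeg e := by
  intro hz'
  obtain ⟨x, d⟩ := e
  obtain ⟨hx, hxd⟩ := he
  simp only at hx hxd
  rcases huv with rfl | huv
  · rw [segment_same, mem_singleton_iff] at hz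
    subst hz
    exact toComplex_notMem_dualSeg u _ hz'
  · obtain ⟨d₁, rfl⟩ := ODir.exists_eq_add_vec_of_adj huv
    rcases eq_or_eq_of_mem_primalSeg_of_mem_dualSeg (hz : z ∈ primalSeg (u, d₁)) hz' with
      ⟨rfl, rfl⟩ | ⟨rfl, h⟩
    · rcases hA with ⟨-, h⟩ | ⟨h, -⟩
      · exact hxd h
      · exact h hx
    · rcases hA with ⟨h', -⟩ | ⟨-, h'⟩
      · exact hxd (by rw [h]; exact h')
      · exact h' hx

/-- The polygon of a lattice walk inside `A`, or inside the complement of `A`, misses the dual segment of every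
boundary edge of `A`. [folklore] -/
theorem walkPath_notMem_dualSeg {A : Set (Site 2)} {e : Site 2 × ODir} (he : IsBEdge A e) {a b : Site 2}
    (p : (zdGraph 2).Walk a b) (hp : (∀ z ∈ p.support, z ∈ A) ∨ (∀ z ∈ p.support, z ∉ A))
    (t : unitInterval) : walkPath p t ∉ dualSeg e := by
  obtain ⟨u, hu, v, hv, huv, hz⟩ := exists_mem_segment_of_mem_range_walkPath p (mem_range_self t)
  refine notMem_dualSeg_of_mem_segment he huv ?_ hz
  rcases hp with h | h
  · exact Or.inl ⟨h u hu, h v hv⟩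
  · exact Or.inr ⟨h u hu, h v hv⟩

/-! ### The single-cycle theorem -/

/-- The boundary edges of a finite site set form a finite set. [folklore] -/
private theorem finite_setOf_isBEdge {A : Set (Site 2)} (hA : A.Finite) : {e : Site 2 × ODir | IsBEdge A e}.Finite :=
  (hA.prod Set.finite_univ).subset fun _ he => Set.mk_mem_prod he.1 (Set.mem_univ _)

/-- `btour (m + n)`: first `m` steps, then `n` more. [folklore] -/
private theorem btour_add_eq (A : Set (Site 2)) (e₀ : Site 2 × ODir) (m n : ℕ) :
    btour A e₀ (m + n) = btour A (btour A e₀ m) n := by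
  simp only [btour, ← Function.iterate_add_apply, add_comm]

/-- A positive natural number with a property has a least positive witness. [folklore] -/
private theorem exists_min_pos {p : ℕ → Prop} (h : ∃ n, 0 < n ∧ p n) :
    ∃ N, 0 < N ∧ p N ∧ ∀ m, 0 < m → m < N → ¬ p m := by
  classical
  exact ⟨Nat.find h, (Nat.find_spec h).1, (Nat.find_spec h).2, fun m hm hlt hp => Nat.find_min h hlt ⟨hm, hp⟩⟩

/-- **Registered stub (witness unit U1): the outline of a `4`-connected finite site set with `4`-connected
complement is ONE closed tour.**  For such an `A` the wall-follower tour from any boundary edge `e` passes through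
every boundary edge `e'`.  Proof by the winding certificate `exists_mem_range_of_straightCross` (no Jordan curve
theorem): the orbit of `e = (x, d)` is drawn as the closed polygon through its corners, closed by the dual segment
of `e` itself, which the primal edge `[x, x + d]` crosses exactly once (no repeats within the minimal period); the
centres of `x'` and `x` are joined inside `A`, those of `x + d` and `x' + d'` outside `A`, by lattice polygons
missing the outline; so the primal edge of `e' = (x', d')` meets the polygon, i.e. the dual segment of a tour edge,
which must then be `e'`. [folklore] -/
theorem btour_transitive : ∀ (A : Finset (Site 2)), A.Nonempty → (∀ x ∈ A, ∀ y ∈ A, ∃ p : (zdGraph 2).Walk x y, ∀ z ∈ p.support, z ∈ A) → (∀ x y : Site 2, x ∉ A → y ∉ A → ∃ p : (zdGraph 2).Walk x y, ∀ z ∈ p.support, z ∉ A) → ∀ e e' : Site 2 × ODir, IsBEdge (↑A : Set (Site 2)) e → IsBEdge (↑A : Set (Site 2)) e' → ∃ n : ℕ, btour (↑A : Set (Site 2)) e n = e' := by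
  intro A _ hconn hconn' e₀ e' h₀ he'
  obtain ⟨x', d'⟩ := e'
  by_contra hne
  push Not at hne
  -- the tour of `e₀` repeats, `btour e₀ i = btour e₀ j` with `i < j`; the tour edge `e = (x, d) := btour e₀ i`
  -- returns to itself after `j - i` steps; `N` := its minimal return time (no return at the steps `0 < m < N`)
  obtain ⟨i, j, hij, hrep⟩ := (finite_setOf_isBEdge A.finite_toSet).exists_lt_map_eq_of_forall_mem
    (f := btour (A : Set (Site 2)) e₀) fun n => btour_isBEdge _ h₀ n
  rcases hf : btour (A : Set (Site 2)) e₀ i with ⟨x, d⟩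
  have he : IsBEdge (A : Set (Site 2)) (x, d) := by
    have := btour_isBEdge (A : Set (Site 2)) h₀ i
    rwa [hf] at this
  obtain ⟨N, hN0, hNe, hmin⟩ : ∃ N, 0 < N ∧ btour (A : Set (Site 2)) (x, d) N = (x, d) ∧
      ∀ m, 0 < m → m < N → btour (A : Set (Site 2)) (x, d) m ≠ (x, d) := by
    refine exists_min_pos ⟨j - i, Nat.sub_pos_of_lt hij, ?_⟩
    rw [← hf, ← btour_add_eq, Nat.add_sub_cancel' hij.le]
    exact hrep.symm
  -- `e'` is not on the orbit of `(x, d)` either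
  have hne' : ∀ n, btour (A : Set (Site 2)) (x, d) n ≠ (x', d') :=
    fun n h => hne (i + n) (by rw [btour_add_eq, hf, h])
  -- the closing path `γ`: the dual segments of the tour edges `1, …, N - 1`, from the end corner of `(x, d)` back
  -- to its start corner
  obtain ⟨γ₀, hγ₀⟩ := exists_path_btour (A : Set (Site 2)) (x, d) 1 (N - 1)
  have h1 : corner (btour (A : Set (Site 2)) (x, d) 1) = corner (x, d) + d.ccw.cvec :=
    corner_btour_succ (A : Set (Site 2)) (x, d) 0
  have h2 : corner (btour (A : Set (Site 2)) (x, d) (1 + (N - 1))) = corner (x, d) := by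
    rw [show 1 + (N - 1) = N by omega, hNe]
  obtain ⟨γ, hγ⟩ : ∃ γ : Path (corner (x, d) + d.ccw.cvec) (corner (x, d)),
      ∀ t, γ t = corner (btour (A : Set (Site 2)) (x, d) 1) ∨
        ∃ j, 1 ≤ j ∧ j < 1 + (N - 1) ∧ γ t ∈ dualSeg (btour (A : Set (Site 2)) (x, d) j) :=
    ⟨γ₀.cast h1.symm h2.symm, hγ₀⟩
  -- every point of the loop lies on the dual segment of a tour edge
  have hL : ∀ s ∈ Icc (0 : ℝ) 1, ∃ j, straightLoop (corner (x, d)) (corner (x, d) + d.ccw.cvec) γ s ∈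
      dualSeg (btour (A : Set (Site 2)) (x, d) j) := by
    intro s hs
    rcases range_straightLoop_subset γ hs with h | ⟨t, ht⟩
    · exact ⟨0, h⟩
    · rw [← ht]
      rcases hγ t with h | ⟨j, -, -, hj⟩
      · exact ⟨1, by rw [h]; exact left_mem_segment ℝ _ _⟩
      · exact ⟨j, hj⟩
  -- `γ` misses the primal edge `[x, x + d]`: its end point is off the line, and a common point with the dual
  -- segment of the tour edge `j`, `1 ≤ j < N`, would force that edge to be `(x, d)` (a repeat) or to have its
  -- outline site at `x + d ∉ A`
  have hγmiss : ∀ t, γ t ∉ segment ℝ (Site.toComplex x) (Site.toComplex (x + d.vec)) := by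
    intro t ht
    rcases hγ t with h | ⟨j, hj1, hjN, hj⟩
    · refine (segSide_corner x d).2.ne ?_
      rw [← h1, ← h]
      exact segSide_eq_zero_of_mem_segment ht
    · rcases hbt : btour (A : Set (Site 2)) (x, d) j with ⟨xj, dj⟩
      rw [hbt] at hj
      have hbj := btour_isBEdge (A : Set (Site 2)) he j
      rw [hbt] at hbj
      rcases eq_or_eq_of_mem_primalSeg_of_mem_dualSeg (ht : γ t ∈ primalSeg (x, d)) hj with
        ⟨rfl, rfl⟩ | ⟨rfl, -⟩
      · exact hmin j hj1 (by omega) hbt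
      · exact he.2 hbj.1
  -- lattice polygons inside `A` / outside `A` miss the loop
  have hmiss : ∀ {a b : Site 2} (p : (zdGraph 2).Walk a b),
      ((∀ z ∈ p.support, z ∈ (A : Set (Site 2))) ∨ (∀ z ∈ p.support, z ∉ (A : Set (Site 2)))) →
      ∀ t, ∀ s ∈ Icc (0 : ℝ) 1,
        walkPath p t ≠ straightLoop (corner (x, d)) (corner (x, d) + d.ccw.cvec) γ s := by
    intro a b p hp t s hs h
    obtain ⟨j, hj⟩ := hL s hs
    rw [← h] at hj
    exact walkPath_notMem_dualSeg (btour_isBEdge _ he j) p hp t hj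
  -- the certificate: the primal edge of `(x', d')` meets the loop …
  obtain ⟨pz, hpz⟩ := hconn x' he'.1 x he.1
  obtain ⟨pw, hpw⟩ := hconn' (x + d.vec) (x' + d'.vec) he.2 he'.2
  obtain ⟨t, s, hs, hts⟩ := exists_mem_range_of_straightCross γ (segSide_corner x d).1 (segSide_corner x d).2
    (exists_mem_dualSeg_mem_openSegment x d) hγmiss (walkPath pz) (hmiss pz (Or.inl hpz)) (walkPath pw)
    (hmiss pw (Or.inr hpw)) (Path.segment (Site.toComplex x') (Site.toComplex (x' + d'.vec)))
  -- … on the dual segment of some tour edge, which must be `(x', d')`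
  obtain ⟨j, hj⟩ := hL s hs
  rw [← hts] at hj
  have hβ : Path.segment (Site.toComplex x') (Site.toComplex (x' + d'.vec)) t ∈ primalSeg (x', d') := by
    rw [primalSeg, ← Path.range_segment]; exact mem_range_self t
  rcases hbt : btour (A : Set (Site 2)) (x, d) j with ⟨xj, dj⟩
  rw [hbt] at hj
  have hbj := btour_isBEdge (A : Set (Site 2)) he j
  rw [hbt] at hbj
  rcases eq_or_eq_of_mem_primalSeg_of_mem_dualSeg hβ hj with ⟨rfl, rfl⟩ | ⟨-, h⟩
  · exact hne' j hbt
  · have h' : xj + dj.vec ∉ (A : Set (Site 2)) := hbj.2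
    rw [h] at h'
    exact h' he'.1

end Summit.CriticalPhenomena.SAWScalingLimit.Theorems.FKGToTraversalBound.SlitNecklace

end
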